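import Summits.AtomisticToContinuum.HydrodynamicLimit.Theorems.CollisionIsometryCLTMacroClosureTwoScaleDefs
import HarnessLib

/-!
# The cells of a shifted tiling partition the torus (input of `stub_blockMGF_twoScale`,
line `IdeatorTwoGen1Sketch`, crux `MacroClosure`, stmt-AtomisticToContinuum-14870)

Proof file (`--supports stmt-AtomisticToContinuum-14870`) for the registered stub `Barycentric.stub_twoScale_cells`.
-/

noncomputable section

open MeasureTheory Filter Set Topology InformationTheory
open scoped ENNReal ContDiff Convolution

namespace Summit.AtomisticToContinuum.HydrodynamicLimit.Theorems.MacroClosureLine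

open Literature.MathematicalPhysics.KineticTheory Literature.Analysis.FluidPDE
open Literature.Analysis.FunctionSpaces

namespace Barycentric


/-! ## Private helpers: the cube with lower corner `κ/M` in fundamental-domain coordinates -/

/-- For `t ∈ [0,1)`, `0 ≤ a`, `0 ≤ ℓ`, `a + ℓ ≤ 1`: the fractional part of `t - a` is `< ℓ` iff
`a ≤ t < a + ℓ` (if `t ≥ a` it is `t - a ∈ [0,1)`; if `t < a` it is `t - a + 1 ≥ 1 - a ≥ ℓ`). -/
private theorem fract_sub_lt_iff {t a ℓ : ℝ} (ht0 : 0 ≤ t) (ht1 : t < 1) (ha : 0 ≤ a)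
    (hℓ : 0 ≤ ℓ) (haℓ : a + ℓ ≤ 1) : Int.fract (t - a) < ℓ ↔ a ≤ t ∧ t < a + ℓ := by
  by_cases hat : a ≤ t
  · rw [Int.fract_eq_self.2 ⟨sub_nonneg.2 hat, by linarith⟩]
    exact ⟨fun h => ⟨hat, by linarith⟩, fun h => by linarith [h.2]⟩
  · push Not at hat
    have h1 : Int.fract (t - a) = t - a + 1 := by
      rw [← Int.fract_add_one, Int.fract_eq_self.2 ⟨by linarith, by linarith⟩]
    rw [h1]
    exact ⟨fun h => absurd h (not_lt.2 (by linarith)), fun h => absurd h.1 (not_le.2 hat)⟩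

/-- The fundamental-domain coordinate of a real number `s` viewed on the unit circle is its
fractional part. -/
private theorem equivIco_coe_eq_fract (s : ℝ) :
    ((AddCircle.equivIco (1 : ℝ) (0 : ℝ) ((s : ℝ) : UnitAddCircle) : ℝ)) = Int.fract s := by
  rw [AddCircle.coe_equivIco_mk_apply]
  simp

/-- Coordinates of the representative of `u - proj c`: the fractional part of `repr u - c`. -/
private theorem repr_sub_proj_apply (u : T3) (c : EuclideanSpace ℝ (Fin 3)) (l : Fin 3) :
    Torus.repr (u - Torus.proj c) l = Int.fract (Torus.repr u l - c l) := by
  have hul : u l = ((Torus.repr u l : ℝ) : UnitAddCircle) := by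
    have h := congrFun (Torus.proj_repr u) l
    rw [Torus.proj_apply] at h
    exact h.symm
  have hu : (u - Torus.proj c) l = (((Torus.repr u l - c l : ℝ)) : UnitAddCircle) := by
    rw [AddCircle.coe_sub, Pi.sub_apply, hul, Torus.proj_apply]
  rw [Torus.repr_apply, hu, equivIco_coe_eq_fract]

/-- **Key fact**: `u` lies in the cube of side `1/M` with lower corner `proj (κ/M)` iff its
representative lies in the lattice cell `Q_κ = ∏ [κᵢ/M, (κᵢ+1)/M)`. -/
private theorem inCube_sub_cellCorner_iff {M : ℕ} (hM : 0 < M) (u : T3) (κ : Fin 3 → Fin M) :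
    inCube ((M : ℝ)⁻¹) (u - Torus.proj (Torus.cellCorner M κ)) ↔
      Torus.repr u ∈ Torus.latticeCell M (fun i => ((κ i : ℕ) : ℤ)) := by
  have hM' : (0 : ℝ) < M := by exact_mod_cast hM
  rw [Torus.mem_latticeCell]
  unfold inCube
  refine forall_congr' fun l => ?_
  rw [repr_sub_proj_apply, Torus.cellCorner_apply, Set.mem_Ico, Int.cast_natCast]
  have ht := Torus.repr_apply_mem_Ico u l
  have hκ : ((κ l : ℕ) : ℝ) + 1 ≤ M := by exact_mod_cast (κ l).isLt
  have ha : 0 ≤ ((κ l : ℕ) : ℝ) / M := div_nonneg (Nat.cast_nonneg _) hM'.le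
  have hsum : ((κ l : ℕ) : ℝ) / M + (M : ℝ)⁻¹ = (((κ l : ℕ) : ℝ) + 1) / M := by
    rw [inv_eq_one_div, ← add_div]
  have haℓ : ((κ l : ℕ) : ℝ) / M + (M : ℝ)⁻¹ ≤ 1 := by
    rw [hsum, div_le_one hM']
    exact hκ
  rw [fract_sub_lt_iff ht.1 ht.2 ha (inv_nonneg.2 hM'.le) haℓ, hsum]

/-- **The cells of a shifted tiling partition the torus** (registered stub `stub_twoScale_cells`). [folklore] -/
theorem stub_twoScale_cells : ∀ (M : ℕ), 0 < M → ∀ x : T3,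
    (∀ κ : Fin 3 → Fin M, MeasurableSet {y : T3 | inCube ((M : ℝ)⁻¹) (y - (x + Torus.proj (Torus.cellCorner M κ)))}) ∧
    (∀ κ κ' : Fin 3 → Fin M, κ ≠ κ' → Disjoint {y : T3 | inCube ((M : ℝ)⁻¹) (y - (x + Torus.proj (Torus.cellCorner M κ)))}
      {y : T3 | inCube ((M : ℝ)⁻¹) (y - (x + Torus.proj (Torus.cellCorner M κ')))}) ∧
    (∀ y : T3, ∃ κ : Fin 3 → Fin M, inCube ((M : ℝ)⁻¹) (y - (x + Torus.proj (Torus.cellCorner M κ)))) ∧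
    (∀ (N : ℕ) (z : Config (N + 1) (Fin 3) T3),
      (∀ κ κ' : Fin 3 → Fin M, κ ≠ κ' → Disjoint (cellSet ((M : ℝ)⁻¹) z (x + Torus.proj (Torus.cellCorner M κ)))
        (cellSet ((M : ℝ)⁻¹) z (x + Torus.proj (Torus.cellCorner M κ')))) ∧
      ∑ κ : Fin 3 → Fin M, cellCount ((M : ℝ)⁻¹) z (x + Torus.proj (Torus.cellCorner M κ)) = N + 1) := by
  intro M hM x
  -- the cells of the shifted tiling as preimages of lattice cells under `y ↦ repr (y - x)`
  have hS : ∀ κ : Fin 3 → Fin M,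
      {y : T3 | inCube ((M : ℝ)⁻¹) (y - (x + Torus.proj (Torus.cellCorner M κ)))} =
        (fun y : T3 => Torus.repr (y - x)) ⁻¹' Torus.latticeCell M (fun i => ((κ i : ℕ) : ℤ)) := by
    intro κ
    ext y
    rw [Set.mem_setOf_eq, Set.mem_preimage, sub_add_eq_sub_sub, inCube_sub_cellCorner_iff hM]
  have hmeas : Measurable (fun y : T3 => Torus.repr (y - x)) :=
    Torus.measurable_repr.comp (measurable_id.sub_const x)
  have hdisj : ∀ κ κ' : Fin 3 → Fin M, κ ≠ κ' →
      Disjoint {y : T3 | inCube ((M : ℝ)⁻¹) (y - (x + Torus.proj (Torus.cellCorner M κ)))}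
        {y : T3 | inCube ((M : ℝ)⁻¹) (y - (x + Torus.proj (Torus.cellCorner M κ')))} := by
    intro κ κ' h
    rw [hS, hS]
    exact (Torus.pairwiseDisjoint_latticeCell hM h).preimage _
  have hcover : ∀ y : T3, ∃ κ : Fin 3 → Fin M,
      inCube ((M : ℝ)⁻¹) (y - (x + Torus.proj (Torus.cellCorner M κ))) := by
    intro y
    have hy : Torus.repr (y - x) ∈ Torus.unitCube (Fin 3) := Torus.repr_mem_unitCube _
    rw [Torus.unitCube_eq_iUnion_latticeCell hM, Set.mem_iUnion] at hy
    obtain ⟨κ, hκ⟩ := hy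
    exact ⟨κ, by rw [sub_add_eq_sub_sub, inCube_sub_cellCorner_iff hM]; exact hκ⟩
  refine ⟨fun κ => ?_, hdisj, hcover, fun N z => ?_⟩
  · rw [hS]
    exact Torus.measurableSet_latticeCell.preimage hmeas
  · have hmem : ∀ (κ : Fin 3 → Fin M) (i : Fin (N + 1)),
        i ∈ cellSet ((M : ℝ)⁻¹) z (x + Torus.proj (Torus.cellCorner M κ)) ↔
          inCube ((M : ℝ)⁻¹) ((z i).1 - (x + Torus.proj (Torus.cellCorner M κ))) := by
      intro κ i
      simp [cellSet]
    have hdisjF : ∀ κ κ' : Fin 3 → Fin M, κ ≠ κ' →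
        Disjoint (cellSet ((M : ℝ)⁻¹) z (x + Torus.proj (Torus.cellCorner M κ)))
          (cellSet ((M : ℝ)⁻¹) z (x + Torus.proj (Torus.cellCorner M κ'))) := by
      intro κ κ' h
      rw [Finset.disjoint_left]
      intro i hi hi'
      rw [hmem] at hi hi'
      have hyi : (z i).1 ∈
          {y : T3 | inCube ((M : ℝ)⁻¹) (y - (x + Torus.proj (Torus.cellCorner M κ)))} := hi
      exact Set.disjoint_left.1 (hdisj κ κ' h) hyi hi'
    refine ⟨hdisjF, ?_⟩
    unfold cellCount
    rw [← Finset.card_biUnion (fun κ _ κ' _ h => hdisjF κ κ' h)]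
    have hU : (Finset.univ.biUnion fun κ : Fin 3 → Fin M =>
        cellSet ((M : ℝ)⁻¹) z (x + Torus.proj (Torus.cellCorner M κ))) = Finset.univ := by
      ext i
      simp only [Finset.mem_biUnion, Finset.mem_univ, true_and, iff_true]
      obtain ⟨κ, hκ⟩ := hcover (z i).1
      exact ⟨κ, (hmem κ i).2 hκ⟩
    rw [hU, Finset.card_univ, Fintype.card_fin]

end Barycentric

end Summit.AtomisticToContinuum.HydrodynamicLimit.Theorems.MacroClosureLine

end
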